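import Summits.QuantumFields.YangMills.Theorems.FemtoTransferGapAdjoint
import HarnessLib

/-!
# The tangent (colour-vector) chart of the Frobenius-linear link coordinates: exact two-link and plaquette identities
# (bridge `…MagneticQuadratic` (Frobenius) ↔ `…StiffHessian` (colour vectors); lane B of S-BASE, crux `TwistedTraceScaling` stmt-QuantumFields-20203)

Write `U ∈ SU(2)` as the unit quaternion `(s, v)`, `s = scalarPart U`, `v = vecPart U ∈ ℝ³` (tree `FemtoTransferGapAdjoint`; `s² + |v|² = 1`,
`‖U − 1‖_F² = 4(1 − s)`).  In these coordinates the two exact Gaussians of the near-vacuum analysis read: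

* §1 ★ `frobNorm_sub_sq_eq` — the KINETIC exponent is exactly quaternionic-Euclidean:
  `‖U − V‖_F² = 2·((s_U − s_V)² + Σ_a (v_U − v_V)_a²)`, so `latE = e^{2β|E|}·e^{−βΣ_e|v_e − v'_e|²}·e^{−βΣ_e(s_e − s'_e)²}`
  (`…ElectricSplit.latE_eq_exp_frobSq`); the scalar factor is a fourth-order correction: `scalarPart_sub_sq_le`
  `(s_U − s_V)² ≤ (Σ_a (v_U−v_V)_a²)·(|v_U|² + |v_V|²)·…` in the hemisphere `s ≥ ½` — precisely `(s_U − s_V)² ≤ 4(|v_U|²+|v_V|²)·Σ_a(v_U−v_V)_a²`.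
* §2 ★ `half_frobNorm_curl_sq_eq` — the MAGNETIC quadratic form of `…MagneticQuadratic` is the colour-vector curl plus an exact non-negative
  quartic: `½‖F₁ + F₂ − F₃ − F₄‖_F² = Σ_a (v₁ + v₂ − v₃ − v₄)_a² + ((s₁−1) + (s₂−1) − (s₃−1) − (s₄−1))²`, `Fᵢ = Uᵢ − 1`, and in the hemisphere
  `0 ≤ 1 − sᵢ ≤ |vᵢ|²` (`one_sub_scalarPart_le`), so the correction is `≤ (Σᵢ |vᵢ|²)²` (`curl_correction_le`).

Hence near the vacuum `2 − Re tr U_p = Σ_a ((dv)_p)_a² + O(|v|³)` with `d` the lattice curl of `…StiffHessian` — the harmonic model there is the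
quadratic part of the true kernel in the chart.  HONEST FRAMING: exact algebra of one/two/four unit quaternions; femto rung R2b1 (stub of a child of
a CONDITIONAL route); not a gap, not Clay.
-/

set_option autoImplicit false

noncomputable section

open scoped Matrix ComplexConjugate BigOperators
open Literature.MathematicalPhysics.QuantumFieldTheory
open Literature.MathematicalPhysics.QuantumLattice

namespace Summit.QuantumFields.YangMills.Theorems.FemtoTransferGap.TwoLattice.Chart

open Summit.QuantumFields.YangMills.Theorems.FemtoTransferGap

/-! ## §0 Entries of an `SU(2)` matrix in the chart -/

/-- The four entries of `U ∈ SU(2)`: `U₀₀ = s + i v₀`, `U₀₁ = v₁ + i v₂`, `U₁₀ = −v₁ + i v₂`, `U₁₁ = s − i v₀`. [folklore] -/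
theorem entries (U : SU2) :
    ((U : Matrix (Fin 2) (Fin 2) ℂ) 0 0).re = scalarPart U ∧ ((U : Matrix (Fin 2) (Fin 2) ℂ) 0 0).im = vecPart U 0 ∧
    ((U : Matrix (Fin 2) (Fin 2) ℂ) 0 1).re = vecPart U 1 ∧ ((U : Matrix (Fin 2) (Fin 2) ℂ) 0 1).im = vecPart U 2 ∧
    ((U : Matrix (Fin 2) (Fin 2) ℂ) 1 0).re = -vecPart U 1 ∧ ((U : Matrix (Fin 2) (Fin 2) ℂ) 1 0).im = vecPart U 2 ∧
    ((U : Matrix (Fin 2) (Fin 2) ℂ) 1 1).re = scalarPart U ∧ ((U : Matrix (Fin 2) (Fin 2) ℂ) 1 1).im = -vecPart U 0 := by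
  refine ⟨rfl, rfl, rfl, rfl, ?_, ?_, ?_, ?_⟩
  · rw [su2_apply_10, Complex.neg_re, Complex.conj_re]; rfl
  · rw [su2_apply_10, Complex.neg_im, Complex.conj_im, neg_neg]; rfl
  · rw [su2_apply_11, Complex.conj_re]; rfl
  · rw [su2_apply_11, Complex.conj_im]; rfl

/-- `‖M‖_F²` of a `2×2` complex matrix in real and imaginary parts of its entries. [cite: HornJohnson2013, (0.2.5)] -/
theorem frobNorm_sq_two (M : Matrix (Fin 2) (Fin 2) ℂ) :
    frobNorm M ^ 2 = ((M 0 0).re ^ 2 + (M 0 0).im ^ 2) + ((M 0 1).re ^ 2 + (M 0 1).im ^ 2)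
      + ((M 1 0).re ^ 2 + (M 1 0).im ^ 2) + ((M 1 1).re ^ 2 + (M 1 1).im ^ 2) := by
  rw [frobNorm_sq]
  simp only [Fin.sum_univ_two, Complex.sq_norm, Complex.normSq_apply]
  ring

/-! ## §1 Two links: the kinetic exponent -/

/-- ★ **The kinetic exponent in the chart**: `‖U − V‖_F² = 2·((s_U − s_V)² + Σ_a (v_U − v_V)_a²)` — exactly the Euclidean distance of the unit
quaternions. [cite: MontvayMunster1994, §3.2.3 (3.97)] -/
theorem frobNorm_sub_sq_eq (U V : SU2) :
    frobNorm ((U : Matrix (Fin 2) (Fin 2) ℂ) - (V : Matrix (Fin 2) (Fin 2) ℂ)) ^ 2 =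
      2 * ((scalarPart U - scalarPart V) ^ 2 + ∑ a, (vecPart U a - vecPart V a) ^ 2) := by
  obtain ⟨u1, u2, u3, u4, u5, u6, u7, u8⟩ := entries U
  obtain ⟨w1, w2, w3, w4, w5, w6, w7, w8⟩ := entries V
  rw [frobNorm_sq_two]
  simp only [Matrix.sub_apply, Complex.sub_re, Complex.sub_im, u1, u2, u3, u4, u5, u6, u7, u8, w1, w2, w3, w4, w5, w6, w7, w8,
    Fin.sum_univ_three]
  ring

/-- In the hemisphere the scalar part is recessive: `0 ≤ 1 − s ≤ |v|²` for `s ≥ 0` (`1 − s = |v|²/(1+s)`). [folklore] -/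
theorem one_sub_scalarPart_le (U : SU2) (h : 0 ≤ scalarPart U) : 0 ≤ 1 - scalarPart U ∧ 1 - scalarPart U ≤ ∑ a, vecPart U a ^ 2 := by
  have hv := sum_vecPart_sq U
  have h1 := abs_scalarPart_le U
  rw [abs_le] at h1
  constructor
  · linarith [h1.2]
  · rw [hv]; nlinarith [h1.2]

/-- ★ **The scalar factor of the kinetic Gaussian is fourth order**: for `s_U, s_V ≥ ½`,
`(s_U − s_V)² ≤ 4·(|v_U|² + |v_V|²)·Σ_a (v_U − v_V)_a²`  (`s_U − s_V = (|v_V|² − |v_U|²)/(s_U + s_V)`). [folklore] -/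
theorem scalarPart_sub_sq_le (U V : SU2) (hU : 1 / 2 ≤ scalarPart U) (hV : 1 / 2 ≤ scalarPart V) :
    (scalarPart U - scalarPart V) ^ 2 ≤
      4 * ((∑ a, vecPart U a ^ 2) + ∑ a, vecPart V a ^ 2) * ∑ a, (vecPart U a - vecPart V a) ^ 2 := by
  have hu := sum_vecPart_sq U
  have hv := sum_vecPart_sq V
  simp only [Fin.sum_univ_three] at hu hv ⊢
  -- names for the eight real coordinates
  generalize scalarPart U = s at *
  generalize scalarPart V = t at *
  generalize vecPart U 0 = a₀ at *
  generalize vecPart U 1 = a₁ at *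
  generalize vecPart U 2 = a₂ at *
  generalize vecPart V 0 = b₀ at *
  generalize vecPart V 1 = b₁ at *
  generalize vecPart V 2 = b₂ at *
  -- `(s − t)(s + t) = |b|² − |a|²`, `s + t ≥ 1`
  have h1 : (s - t) * (s + t) = (b₀ ^ 2 + b₁ ^ 2 + b₂ ^ 2) - (a₀ ^ 2 + a₁ ^ 2 + a₂ ^ 2) := by nlinarith
  have hst : 1 ≤ s + t := by linarith
  have h2 : (s - t) ^ 2 ≤ ((b₀ ^ 2 + b₁ ^ 2 + b₂ ^ 2) - (a₀ ^ 2 + a₁ ^ 2 + a₂ ^ 2)) ^ 2 := by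
    rw [← h1, mul_pow]
    have h0 : 0 ≤ (s - t) ^ 2 := sq_nonneg _
    have h1' : 1 ≤ (s + t) ^ 2 := by nlinarith
    nlinarith
  -- `(|b|² − |a|²)² = (Σ (a−b)(a+b))² ≤ Σ(a−b)² · Σ(a+b)² ≤ Σ(a−b)² · 2(|a|²+|b|²)`
  have h3 : ((b₀ ^ 2 + b₁ ^ 2 + b₂ ^ 2) - (a₀ ^ 2 + a₁ ^ 2 + a₂ ^ 2)) ^ 2 ≤
      ((a₀ - b₀) ^ 2 + (a₁ - b₁) ^ 2 + (a₂ - b₂) ^ 2) * ((a₀ + b₀) ^ 2 + (a₁ + b₁) ^ 2 + (a₂ + b₂) ^ 2) := by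
    have e : (b₀ ^ 2 + b₁ ^ 2 + b₂ ^ 2) - (a₀ ^ 2 + a₁ ^ 2 + a₂ ^ 2) =
        -((a₀ - b₀) * (a₀ + b₀) + (a₁ - b₁) * (a₁ + b₁) + (a₂ - b₂) * (a₂ + b₂)) := by ring
    rw [e, neg_sq]
    -- Cauchy–Schwarz in `ℝ³` (Lagrange's identity)
    nlinarith [sq_nonneg ((a₀ - b₀) * (a₁ + b₁) - (a₁ - b₁) * (a₀ + b₀)), sq_nonneg ((a₀ - b₀) * (a₂ + b₂) - (a₂ - b₂) * (a₀ + b₀)),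
      sq_nonneg ((a₁ - b₁) * (a₂ + b₂) - (a₂ - b₂) * (a₁ + b₁))]
  have h4 : (a₀ + b₀) ^ 2 + (a₁ + b₁) ^ 2 + (a₂ + b₂) ^ 2 ≤ 2 * ((a₀ ^ 2 + a₁ ^ 2 + a₂ ^ 2) + (b₀ ^ 2 + b₁ ^ 2 + b₂ ^ 2)) := by
    nlinarith [sq_nonneg (a₀ - b₀), sq_nonneg (a₁ - b₁), sq_nonneg (a₂ - b₂)]
  have hD : 0 ≤ (a₀ - b₀) ^ 2 + (a₁ - b₁) ^ 2 + (a₂ - b₂) ^ 2 := by positivity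
  have hAB : 0 ≤ (a₀ ^ 2 + a₁ ^ 2 + a₂ ^ 2) + (b₀ ^ 2 + b₁ ^ 2 + b₂ ^ 2) := by positivity
  calc (s - t) ^ 2 ≤ ((b₀ ^ 2 + b₁ ^ 2 + b₂ ^ 2) - (a₀ ^ 2 + a₁ ^ 2 + a₂ ^ 2)) ^ 2 := h2
    _ ≤ ((a₀ - b₀) ^ 2 + (a₁ - b₁) ^ 2 + (a₂ - b₂) ^ 2) * ((a₀ + b₀) ^ 2 + (a₁ + b₁) ^ 2 + (a₂ + b₂) ^ 2) := h3
    _ ≤ ((a₀ - b₀) ^ 2 + (a₁ - b₁) ^ 2 + (a₂ - b₂) ^ 2) * (2 * ((a₀ ^ 2 + a₁ ^ 2 + a₂ ^ 2) + (b₀ ^ 2 + b₁ ^ 2 + b₂ ^ 2))) :=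
        mul_le_mul_of_nonneg_left h4 hD
    _ ≤ 4 * ((a₀ ^ 2 + a₁ ^ 2 + a₂ ^ 2) + (b₀ ^ 2 + b₁ ^ 2 + b₂ ^ 2)) * ((a₀ - b₀) ^ 2 + (a₁ - b₁) ^ 2 + (a₂ - b₂) ^ 2) := by
        nlinarith [mul_nonneg hD hAB]

/-! ## §2 Four links: the magnetic quadratic form -/

/-- ★ **The curl quadratic form in the chart**: with `Fᵢ = Uᵢ − 1`,
`½‖F₁ + F₂ − F₃ − F₄‖_F² = Σ_a (v₁ + v₂ − v₃ − v₄)_a² + ((s₁−1) + (s₂−1) − (s₃−1) − (s₄−1))²` — exactly. [cite: Luscher1983, §3] -/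
theorem half_frobNorm_curl_sq_eq (U₁ U₂ U₃ U₄ : SU2) :
    frobNorm (((U₁ : Matrix (Fin 2) (Fin 2) ℂ) - 1) + ((U₂ : Matrix (Fin 2) (Fin 2) ℂ) - 1)
        - ((U₃ : Matrix (Fin 2) (Fin 2) ℂ) - 1) - ((U₄ : Matrix (Fin 2) (Fin 2) ℂ) - 1)) ^ 2 / 2 =
      (∑ a, (vecPart U₁ a + vecPart U₂ a - vecPart U₃ a - vecPart U₄ a) ^ 2) +
        ((scalarPart U₁ - 1) + (scalarPart U₂ - 1) - (scalarPart U₃ - 1) - (scalarPart U₄ - 1)) ^ 2 := by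
  obtain ⟨a1, a2, a3, a4, a5, a6, a7, a8⟩ := entries U₁
  obtain ⟨b1, b2, b3, b4, b5, b6, b7, b8⟩ := entries U₂
  obtain ⟨c1, c2, c3, c4, c5, c6, c7, c8⟩ := entries U₃
  obtain ⟨d1, d2, d3, d4, d5, d6, d7, d8⟩ := entries U₄
  rw [frobNorm_sq_two]
  simp only [Matrix.sub_apply, Matrix.add_apply, Matrix.one_apply_eq, Matrix.one_apply_ne (by decide : (0 : Fin 2) ≠ 1),
    Matrix.one_apply_ne (by decide : (1 : Fin 2) ≠ 0), Complex.sub_re, Complex.sub_im, Complex.add_re, Complex.add_im,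
    Complex.one_re, Complex.one_im, Complex.zero_re, Complex.zero_im,
    a1, a2, a3, a4, a5, a6, a7, a8, b1, b2, b3, b4, b5, b6, b7, b8, c1, c2, c3, c4, c5, c6, c7, c8, d1, d2, d3, d4, d5, d6, d7, d8,
    Fin.sum_univ_three]
  ring

/-- ★ **The chart correction of the curl form is quartic**: in the hemisphere (`sᵢ ≥ 0`),
`0 ≤ ((s₁−1) + (s₂−1) − (s₃−1) − (s₄−1))² ≤ (Σᵢ |vᵢ|²)²`. [folklore] -/
theorem curl_correction_le (U₁ U₂ U₃ U₄ : SU2) (h₁ : 0 ≤ scalarPart U₁) (h₂ : 0 ≤ scalarPart U₂) (h₃ : 0 ≤ scalarPart U₃)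
    (h₄ : 0 ≤ scalarPart U₄) :
    ((scalarPart U₁ - 1) + (scalarPart U₂ - 1) - (scalarPart U₃ - 1) - (scalarPart U₄ - 1)) ^ 2 ≤
      ((∑ a, vecPart U₁ a ^ 2) + (∑ a, vecPart U₂ a ^ 2) + (∑ a, vecPart U₃ a ^ 2) + ∑ a, vecPart U₄ a ^ 2) ^ 2 := by
  obtain ⟨p1, q1⟩ := one_sub_scalarPart_le U₁ h₁
  obtain ⟨p2, q2⟩ := one_sub_scalarPart_le U₂ h₂
  obtain ⟨p3, q3⟩ := one_sub_scalarPart_le U₃ h₃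
  obtain ⟨p4, q4⟩ := one_sub_scalarPart_le U₄ h₄
  rw [← sq_abs]
  refine pow_le_pow_left₀ (abs_nonneg _) (abs_le.mpr ⟨?_, ?_⟩) 2 <;> nlinarith

/-- **Magnetic term in the chart** (combine with `…MagneticQuadratic.abs_plaquetteCost_sub_quadratic_le`): in the hemisphere,
`|½‖F₁+F₂−F₃−F₄‖_F² − Σ_a (v₁+v₂−v₃−v₄)_a²| ≤ (Σᵢ |vᵢ|²)²`. [cite: Luscher1983, §3] -/
theorem abs_half_frobNorm_curl_sq_sub_le (U₁ U₂ U₃ U₄ : SU2) (h₁ : 0 ≤ scalarPart U₁) (h₂ : 0 ≤ scalarPart U₂)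
    (h₃ : 0 ≤ scalarPart U₃) (h₄ : 0 ≤ scalarPart U₄) :
    |frobNorm (((U₁ : Matrix (Fin 2) (Fin 2) ℂ) - 1) + ((U₂ : Matrix (Fin 2) (Fin 2) ℂ) - 1)
        - ((U₃ : Matrix (Fin 2) (Fin 2) ℂ) - 1) - ((U₄ : Matrix (Fin 2) (Fin 2) ℂ) - 1)) ^ 2 / 2 -
        ∑ a, (vecPart U₁ a + vecPart U₂ a - vecPart U₃ a - vecPart U₄ a) ^ 2| ≤
      ((∑ a, vecPart U₁ a ^ 2) + (∑ a, vecPart U₂ a ^ 2) + (∑ a, vecPart U₃ a ^ 2) + ∑ a, vecPart U₄ a ^ 2) ^ 2 := by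
  rw [half_frobNorm_curl_sq_eq, add_sub_cancel_left, abs_of_nonneg (sq_nonneg _)]
  exact curl_correction_le U₁ U₂ U₃ U₄ h₁ h₂ h₃ h₄

/-- `‖U − 1‖_F² ≤ 4|v|²` in the hemisphere (so the cubic remainder of `…MagneticQuadratic` is `O(|v|³)`). [folklore] -/
theorem frobNorm_sub_one_sq_le_vec (U : SU2) (h : 0 ≤ scalarPart U) :
    frobNorm ((U : Matrix (Fin 2) (Fin 2) ℂ) - 1) ^ 2 ≤ 4 * ∑ a, vecPart U a ^ 2 := by
  rw [frobNorm_sub_one_sq_eq_scalarPart]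
  have := (one_sub_scalarPart_le U h).2
  linarith

end Summit.QuantumFields.YangMills.Theorems.FemtoTransferGap.TwoLattice.Chart

end
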